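import Literature.Analysis.Hypoelliptic.SchwartzBridge
import Literature.Analysis.Hypoelliptic.EnergyInequality
import Mathlib.Analysis.Normed.Operator.Extend
import Mathlib.Analysis.InnerProductSpace.Dual
import HarnessLib

/-!
# Riesz representation of functionals on the Schwartz space bounded in a weighted `L²` norm

Analysis/Hypoelliptic support file serving the discharge of
`Literature.Analysis.Distribution.Hormander1967_thm11` (construction of the Fourier-side function
of a distribution of finite order).

* `exists_memLp_pairing_eq`: a conjugate-linear functional `A` on `𝓢(V, ℂ)` with
  `‖A ψ‖ ≤ C ‖ψ‖_{L²}` is `ψ ↦ pairing G ψ = ∫ G conj ψ` for some `G ∈ L²` (extension to `L²` by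
  density, `LinearMap.extendOfNorm`, and the Riesz representation `InnerProductSpace.toDual`);
* `exists_inH_pairing_eq`: the weighted version — `‖A ψ‖ ≤ C ‖ψ‖_{M}` gives `G ∈ Ĥ^{-M}` with
  `pairing G ψ = A ψ` for all Schwartz `ψ`.

## References

* L. Hörmander, *The Analysis of Linear Partial Differential Operators I*, §7.9 (folklore).
-/

noncomputable section

open MeasureTheory Set Filter Function SchwartzMap
open scoped ENNReal NNReal Topology ComplexConjugate InnerProductSpace

namespace Literature.Analysis.Hypoelliptic

variable {V : Type*} [NormedAddCommGroup V] [InnerProductSpace ℝ V] [FiniteDimensional ℝ V]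
  [MeasurableSpace V] [BorelSpace V]

/-- `‖ψ‖_{L²} = ‖ψ‖_0 = rn 0 ψ` for a Schwartz function. [folklore] -/
theorem norm_toLp_eq_rn (ψ : 𝓢(V, ℂ)) :
    ‖ψ.toLp 2 (volume : Measure V)‖ = rn 0 (ψ : V → ℂ) := by
  rw [SchwartzMap.norm_toLp]
  unfold rn wnorm
  congr 2
  ext ξ; simp

/-- **Riesz representation on the Schwartz space, `L²` version**: a conjugate-linear functional
bounded in the `L²` norm is `pairing G ·` for some `G ∈ L²`. [folklore] -/
theorem exists_memLp_pairing_eq (A : 𝓢(V, ℂ) → ℂ) (hadd : ∀ ψ φ, A (ψ + φ) = A ψ + A φ)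
    (hsmul : ∀ (c : ℂ) ψ, A (c • ψ) = conj c * A ψ) {C : ℝ}
    (hC : ∀ ψ : 𝓢(V, ℂ), ‖A ψ‖ ≤ C * rn 0 (ψ : V → ℂ)) :
    ∃ G : V → ℂ, MemLp G 2 (volume : Measure V) ∧ ∀ ψ : 𝓢(V, ℂ), pairing G ψ = A ψ := by
  -- `A` as a conjugate-semilinear map
  let Aₗ : 𝓢(V, ℂ) →ₛₗ[starRingEnd ℂ] ℂ :=
    { toFun := A, map_add' := hadd, map_smul' := fun c ψ => by rw [hsmul]; rfl }
  let e : 𝓢(V, ℂ) →ₗ[ℂ] Lp ℂ 2 (volume : Measure V) :=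
    (SchwartzMap.toLpCLM ℂ ℂ 2 (volume : Measure V)).toLinearMap
  have he : ∀ ψ, e ψ = ψ.toLp 2 (volume : Measure V) := fun ψ => rfl
  have hdense : DenseRange e := by
    have := SchwartzMap.denseRange_toLpCLM (F := ℂ) (p := (2 : ℝ≥0∞)) (μ := (volume : Measure V))
      ENNReal.ofNat_ne_top
    -- the `ℝ`-linear and `ℂ`-linear `toLpCLM` are the same function
    convert this using 1
    ext ψ : 1
    rw [he, SchwartzMap.toLpCLM_apply]
  have hnorm : ∃ C, ∀ ψ, ‖Aₗ ψ‖ ≤ C * ‖e ψ‖ := ⟨C, fun ψ => by rw [he, norm_toLp_eq_rn]; exact hC ψ⟩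
  -- extension to `L²` and Riesz
  let Abar : Lp ℂ 2 (volume : Measure V) →SL[starRingEnd ℂ] ℂ := Aₗ.extendOfNorm e
  have hAbar : ∀ ψ, Abar (ψ.toLp 2 (volume : Measure V)) = A ψ := fun ψ => by
    have := LinearMap.extendOfNorm_eq (f := Aₗ) (e := e) hdense hnorm ψ
    rw [he] at this
    exact this
  let B : Lp ℂ 2 (volume : Measure V) →L[ℂ] ℂ :=
    ((starₗᵢ ℂ : ℂ ≃ₗᵢ⋆[ℂ] ℂ).toContinuousLinearEquiv : ℂ →SL[starRingEnd ℂ] ℂ).comp Abar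
  have hB : ∀ f, B f = conj (Abar f) := fun f => rfl
  let y : Lp ℂ 2 (volume : Measure V) := (InnerProductSpace.toDual ℂ _).symm B
  have hy : ∀ f : Lp ℂ 2 (volume : Measure V), ⟪y, f⟫_ℂ = conj (Abar f) := fun f => by
    rw [InnerProductSpace.toDual_symm_apply, hB]
  refine ⟨y, Lp.memLp y, fun ψ => ?_⟩
  -- `pairing y ψ = ⟪toLp ψ, y⟫ = conj ⟪y, toLp ψ⟫ = Abar (toLp ψ) = A ψ`
  have h1 : pairing (y : V → ℂ) ψ = ⟪ψ.toLp 2 (volume : Measure V), y⟫_ℂ := by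
    rw [MeasureTheory.L2.inner_def]
    unfold pairing
    refine integral_congr_ae ?_
    filter_upwards [ψ.coeFn_toLp 2 (volume : Measure V)] with ξ hξ
    rw [hξ]
    simp only [RCLike.inner_apply']
    ring
  rw [h1, ← inner_conj_symm, hy, Complex.conj_conj, hAbar]

/-- **Riesz representation on the Schwartz space, weighted version**: a conjugate-linear
functional with `‖A ψ‖ ≤ C ‖ψ‖_M` is `pairing G ·` for some `G ∈ Ĥ^{-M}`. [folklore] -/
theorem exists_inH_pairing_eq (A : 𝓢(V, ℂ) → ℂ) (hadd : ∀ ψ φ, A (ψ + φ) = A ψ + A φ)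
    (hsmul : ∀ (c : ℂ) ψ, A (c • ψ) = conj c * A ψ) {C M : ℝ}
    (hC : ∀ ψ : 𝓢(V, ℂ), ‖A ψ‖ ≤ C * rn M (ψ : V → ℂ)) :
    ∃ G : V → ℂ, InH (-M) G ∧ ∀ ψ : 𝓢(V, ℂ), pairing G ψ = A ψ := by
  -- `A₀ g := A (⟨·⟩^{-M} g)` is bounded in `L²`
  set A₀ : 𝓢(V, ℂ) → ℂ := fun g => A (bwSchwartz (-M) g) with hA₀
  have hadd₀ : ∀ ψ φ, A₀ (ψ + φ) = A₀ ψ + A₀ φ := fun ψ φ => by simp only [hA₀, map_add, hadd]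
  have hsmul₀ : ∀ (c : ℂ) ψ, A₀ (c • ψ) = conj c * A₀ ψ := fun c ψ => by
    simp only [hA₀, map_smul, hsmul]
  have hC₀ : ∀ ψ : 𝓢(V, ℂ), ‖A₀ ψ‖ ≤ C * rn 0 (ψ : V → ℂ) := fun ψ => by
    have h := hC (bwSchwartz (-M) ψ)
    have e : rn M ((bwSchwartz (-M) ψ : 𝓢(V, ℂ)) : V → ℂ) = rn 0 (ψ : V → ℂ) := by
      unfold rn
      have : ((bwSchwartz (-M) ψ : 𝓢(V, ℂ)) : V → ℂ) = fun ξ => (bw (-M) ξ : ℂ) * ψ ξ := by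
        ext ξ; exact bwSchwartz_apply (-M) ψ ξ
      rw [this, wnorm_bw_mul, show M + -M = 0 by ring]
    rw [e] at h
    exact h
  obtain ⟨G₀, hG₀, hG₀p⟩ := exists_memLp_pairing_eq A₀ hadd₀ hsmul₀ hC₀
  -- `G := ⟨·⟩^{M} G₀`
  refine ⟨fun ξ => (bw M ξ : ℂ) * G₀ ξ, ⟨(Complex.continuous_ofReal.comp (continuous_bw M)).aestronglyMeasurable.mul
    hG₀.1, ?_⟩, fun ψ => ?_⟩
  · rw [wnorm_bw_mul, show -M + M = 0 by ring]
    have : wnorm 0 G₀ = eLpNorm G₀ 2 volume := by unfold wnorm; congr 1; ext ξ; simp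
    rw [this]; exact hG₀.2
  · -- `pairing (⟨·⟩^M G₀) ψ = pairing G₀ (⟨·⟩^M ψ) = A₀ (⟨·⟩^M ψ) = A ψ`
    rw [pairing_mul_left]
    have e : (fun ξ => conj ((bw M ξ : ℂ)) * ψ ξ) = ((bwSchwartz M ψ : 𝓢(V, ℂ)) : V → ℂ) := by
      ext ξ; rw [bwSchwartz_apply, Complex.conj_ofReal]
    rw [e, hG₀p]
    simp only [hA₀]
    congr 1
    ext ξ
    rw [bwSchwartz_apply, bwSchwartz_apply, ← mul_assoc, ← Complex.ofReal_mul, ← bw_add,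
      show -M + M = 0 by ring, bw_zero]
    simp

end Literature.Analysis.Hypoelliptic
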